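import Summits.Parity.BatemanHorn.Theorems.SelbergDelangeRigidityLSDRealSegmentCheapRows
import HarnessLib

/-!
# Route `SelbergDelangeRigidity`, crux `LSDRealSegment` (stmt-Parity-9770), line `product-anatomy-subcritical`:
# the REPAIRED cheap-rows predicate `CheapRowsUnit` (lead's reshape, rev L2)

The registered stub `stub_cheapRows : ∀ k f, IsBatemanHornSystem f → Σ deg fᵢ ≤ 2 → CheapRows k f` of the
checked skeleton `Cruxes/LSDRealSegment/Lines/product_anatomy_subcritical.lean` is FALSE as typed
(`stub_cheapRows_false`, `…CheapRowsFalse.lean`, p103293): for the quadratic member `![X² + 1]` the corner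
`η₀ = 2`, `s = 0`, `η' = 1` of `CheapRows` is admissible (with no boxes the only constraint on the margin is
`0 ≤ deg − η₀`) and asks for relative error `ε` on pure-twist rows with twists `e` as long as the interval `x`,
which fails (one extra root class flips the count by `1` against a main term `≤ 2/5`).  The intended statement has
margins in the unit interval: `CheapRowsUnit k f` below is `CheapRows k f` VERBATIM with the single extra
hypothesis `η₀ ≤ 1` (so the twist level `η' ≤ η₀/2 ≤ 1/2` is sub-level, as in every use the reconstruction makes of
the rows: `η₀` small).  Nothing else changes; `cheapRowsUnit_of_cheapRows` records the implication, and
`cheapRowsUnit_of_sum_natDegree_le_one` transports the PROVED members (`∅`, one linear form) from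
`cheapRows_of_sum_natDegree_le_one` (`…CheapRows.lean`, p104184).  The false corner is gone: with `η₀ ≤ 1` every
pure-twist row has `η' ≤ 1/2 < 1` and is covered by `cheapRows_pureTwist` (`…CheapRowsAux.lean`).
-/

open Filter Finset Polynomial
open scoped BigOperators Topology Classical

namespace Summit.Parity.BatemanHorn.Cruxes.LSDRealSegment.ProductAnatomySubcritical

open Literature.NumberTheory.Sieve

noncomputable section

/-- **CheapRowsUnit k f** — THE REPAIRED OPEN INPUT (sub-critical, smooth moduli, positive main terms, `y`-free):
`CheapRows k f` verbatim with the margin restricted to `0 < η₀ ≤ 1`: for every such margin, every assignment `σ`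
of boxes `(x^{αⱼ}, x^{βⱼ}]` to factors with parts `≤ 1 − η₀`, per-factor totals `≤ deg fᵢ − η₀` and cheap shapes
(`max + total ≤ deg fᵢ + η₀`), and every twist level `η' ≤ η₀/2` (hence `≤ 1/2`): eventually in `x`, UNIFORMLY
over twists `1 ≤ e ≤ x^{η'}` all of whose primes lie below every box, `R_x(e; σ, α, β) = (1 + o(1)) · x Σ δ`
(relative error). [folklore] -/
def CheapRowsUnit (k : ℕ) (f : Fin k → ℤ[X]) : Prop :=
  ∀ η₀ : ℝ, 0 < η₀ → η₀ ≤ 1 → ∀ (s : ℕ) (σ : Fin s → Fin k) (α β : Fin s → ℝ),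
    (∀ j, 0 < α j ∧ α j < β j ∧ β j ≤ 1 - η₀) →
    (∀ i : Fin k, (∑ j ∈ univ.filter (fun j => σ j = i), β j) ≤ ((f i).natDegree : ℝ) - η₀) →
    (∀ j, β j + (∑ j' ∈ univ.filter (fun j' => σ j' = σ j), β j') ≤ ((f (σ j)).natDegree : ℝ) + η₀) →
    ∀ η' : ℝ, 0 < η' → 2 * η' ≤ η₀ → ∀ ε : ℝ, 0 < ε →
      ∀ᶠ x : ℕ in atTop, ∀ e : ℕ, 1 ≤ e → (e : ℝ) ≤ (x : ℝ) ^ η' →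
        (∀ q ∈ e.primeFactors, ∀ j, (q : ℝ) ≤ (x : ℝ) ^ α j) →
          |(cheapRow f σ α β e x : ℝ) - cheapMain f σ α β e x| ≤ ε * cheapMain f σ α β e x

/-- **cheapRowsUnit_of_cheapRows** (registered helper of stmt-Parity-9770): the unrepaired predicate implies the
repaired one (one hypothesis more). [folklore] -/
theorem cheapRowsUnit_of_cheapRows : ∀ (k : ℕ) (f : Fin k → ℤ[X]), CheapRows k f → CheapRowsUnit k f :=
  fun _ _ h η₀ hη₀ _ s σ α β hbox hfac hshape η' hη' h2 ε hε =>
    h η₀ hη₀ s σ α β hbox hfac hshape η' hη' h2 ε hε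

/-- The PROVED members transport: `CheapRowsUnit k f` for every family of total degree `≤ 1` (the empty family and
one linear form), from `cheapRows_of_sum_natDegree_le_one`. [folklore] -/
theorem cheapRowsUnit_of_sum_natDegree_le_one :
    ∀ (k : ℕ) (f : Fin k → ℤ[X]), (∑ i, (f i).natDegree) ≤ 1 → CheapRowsUnit k f :=
  fun k f h => cheapRowsUnit_of_cheapRows k f (cheapRows_of_sum_natDegree_le_one k f h)

end

end Summit.Parity.BatemanHorn.Cruxes.LSDRealSegment.ProductAnatomySubcritical
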